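import Mathlib
import Summits.QuantumFields.BalabanUV.Beta.UnitLatticeProjectionWalk

/-!
# [Balaban1984PropagatorsII] (2.72)–(2.78) p. 236 ∕ [Balaban1985BackgroundPropagators] (3.132) p. 422 — COERCIVITY OF THE
# COARSE OPERATOR `Q·A⁻¹·Q*` FROM AN INEXACT (QUASI-)RECONSTRUCTION: if some map `B ↦ S B = Σ_y B_y s_y` into the fine
# lattice has ENERGY `Re (SB)*A(SB) ≤ E‖B‖²` and its block pairings form a COERCIVE MASS MATRIX `Re (SB)*(Q*B) ≥ c‖B‖²`,
# then `Re B*(QA⁻¹Q*)B ≥ (c²∕E)‖B‖²` — the variational dual of B6's lower bound `Q′_jG′_jQ′_j* ≥ 2γ₀`, with NO Fourier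
# analysis and NO biorthogonality (cell topic `Summits/QuantumFields/BalabanUV/Beta`; row-D4 interface item (I3), the
# coercivity datum of the near-local inverses — NOTE-I3 of the owner lineage)

HONEST FRAMING (cell rule).  Discharging `BetaPertH` makes Bałaban's UV stability UNCONDITIONAL — a real constructive-QFT
result; NOT the continuum limit, NOT the Clay problem.  This module discharges NOTHING of `BetaPertH`.  [folklore]
finite-dimensional linear algebra (completion of squares), kernel-checked.  It GENERALISES the co-owner's
`UnitLatticeProjectionWalk.sandwich_coercive_of_reconstruction` (unit `b2b-balaban-beta-d4-p3`, gen 3: an EXACT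
reconstruction `Qm r·(Qm q)ᴴ = 1` of energy `a` gives coercivity `a⁻¹`) to INEXACT reconstructions: the mass matrix
`Qm r·(Qm q)ᴴ` need only be `Re`-coercive with a constant `c > 0` (conclusion `c²∕E`).  WHY: the object that row D4's
interface item (I3) needs for Bałaban's averaging `Q̃` (NOTE-I3 §3 leaf (b2), `HOME/b2b-balaban-beta-an4/g39/NOTE-I3-coarse-
coercivity.md`) is a BOUNDED-ENERGY extension of coarse data UNIFORMLY in the block size; the exact block-constant
extension `Q̃ᵀ(Q̃Q̃ᵀ)⁻¹` has Dirichlet energy growing with the block size (its jumps sit on `L^{j(d−1)}` boundary bonds of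
weight `ξ^{d−2}`, i.e. `L^j` per coarse bond), and an exactly biorthogonal SMOOTH system costs a Gram inversion — whereas
ANY smooth bump per block (tent, cosine) is a quasi-reconstruction in the sense below with `c`, `E` uniform.  This is the
variational dual of [B6] (2.76) `Q′_jG′_jQ′_j* ≥ 2γ₀` («γ₀ is a positive, absolute constant»), obtained in print from
the Fourier representation (2.75) of [B5]; the dual route transcribes to background fields (covariant bumps), the Fourier
route does not — which is the content of G-B9-15's «analyzed in the same way» (B9 p. 422) isolated by NOTE-I3.  Nothing
of Bałaban's operators is instantiated; NO class change on any GAPS row (G-B9-15 is DECOMPOSED, not closed); readiness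
width 0 unchanged; NOT summit progress.  Unit `b2b-balaban-beta-an4-g39` (owner lineage of `BINDER-OWNERS.md` row D4);
`GAPS.md` C-an4-103.

CITATION HEADER (lean-in-tree rule).  [B6] = T. Bałaban, *Propagators and renormalization transformations for lattice
gauge theories. II*, Commun. Math. Phys. **96**, 223–250 (1984) [Balaban1984PropagatorsII], p. 236 [PDF 14] (render
`HOME/b2b-balaban-ref1/pages/1984-cmp96-propagators-rt-II/…-p014-x2.png`, READ AS IMAGE by this seat 2026-08-20),
verbatim: *"Next we consider the quadratic form ⟨ω₁, Q′_jG′^ξ(□̃)Q′_j*ω₁⟩. Of course it is positive definite and to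
bound it from below we use Eq. (2.42) … From this representation and the bounds (2.50), (2.51) of that paper it follows
that Q′_jG′_jQ′_j* ≥ 2γ₀; (2.76) γ₀ is a positive, absolute constant (a = 1)."*; [13] = T. Bałaban, *Propagators for
lattice gauge theories in a background field*, Commun. Math. Phys. **99**, 389–434 (1985) [Balaban1985BackgroundPropagators],
p. 422 [PDF 34] (render `…/1985-cmp99-background-propagators/…-p034-x2.png`, READ AS IMAGE today), verbatim: *"The
operators (QGQ*)⁻¹, or (QG₁Q*)⁻¹, can be analyzed in the same way as the operator (Q′G′²Q′*)⁻¹. We will not repeat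
these considerations here, let us write only bounds."*  LOCATORS only; nothing printed is asserted.

WHAT IS CERTIFIED HERE (kernel, sorry-free; [folklore]).
§1 **`sandwich_coercive_of_quasiReconstruction`** — `A` Hermitian, invertible, `Re g*Ag ≥ 0`; block test vectors `q`
   (the rows of `Q̃`) and ANY family `r` (the quasi-reconstruction `S = (Qm r)ᴴ`) with MASS COERCIVITY
   `c‖B‖² ≤ Re (Σ_y B_y r_y)*(Σ_y B_y q_y)` and ENERGY `Re (Σ B_y r_y)*A(Σ B_y r_y) ≤ E‖B‖²`, `c > 0`, `E > 0` ⟹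
   `(c²∕E)‖B‖² ≤ Re B*(sandwich A q)B` for every `B` (completion of squares `re_form_inv_ge` with `λ·Σ B_y r_y`,
   `λ = c∕E`).  `sandwich_coercive_of_reconstruction` is the case `c = 1` (`of_exact`).
§2 `massCoercive_of_diagDominant` — a SUFFICIENT condition for the mass coercivity in the form instances meet it: if the
   mass matrix `Mq := Qm r·(Qm q)ᴴ` is HERMITIAN with real diagonal `≥ δ` and absolute off-diagonal row sums `≤ σ < δ`,
   then `c = δ − σ` (Gershgorin-type, by `2|B_yB_{y′}| ≤ |B_y|² + |B_{y′}|²`).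
§3 Non-vacuity ∕ the scalar sanity instance: one fine site, `A = 2`, `q = r = 1`: `c = 1`, `E = 2`, bound `½ ≤ Re B*·½·B`.
NOT CLAIMED.  Any bump construction on Bałaban's lattices (the U = 1 torus instance is the natural next MODEL node);
anything k-uniform about Bałaban's operators; (3.132).  NOT summit progress.
PRIOR ART IN THE TREE (searched 2026-08-20: `lean search 'coercive_of_reconstruction|quasiReconstruction|Gershgorin|
diagDominant'`): d4-p3's exact version (USED: `re_form_inv_ge`, `form_sandwich_eq`, `Qm`, `superpose`, `sandwich` BY
NAME); `Literature/Analysis/Matrix/GramRowSumBound` (Schur∕Gershgorin row-sum UPPER bound for `‖TT*‖` — the opposite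
direction); Mathlib's `Matrix.det_ne_zero_of_sum_row_lt_diag` (Gershgorin for determinants — not the form bound); no
inexact reconstruction lemma.
-/

namespace Summit.QuantumFields.BalabanUV.Beta.CoarseCoerciveQuasiReconstruction

open scoped BigOperators Matrix ComplexConjugate
open Finset Matrix
open Summit.QuantumFields.BalabanUV.Beta.AccretiveCombesThomasSandwich (sandwich)
open Summit.QuantumFields.BalabanUV.Beta.UnitLatticeResolventWalk (Qm superpose form_sandwich_eq)
open Summit.QuantumFields.BalabanUV.Beta.UnitLatticeProjectionWalk (re_form_inv_ge sandwich_coercive_of_reconstruction)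
open Literature.MathematicalPhysics.QuantumFieldTheory.Balaban1983to89.B5Prop11Lower (nsq nsq_nonneg
  star_dotProduct_self)

noncomputable section

variable {X Y : Type*} [Fintype X] [Fintype Y] [DecidableEq X]

/-! ## §1 Coercivity of the sandwich from a quasi-reconstruction -/

/-- **COERCIVITY OF `Q·A⁻¹·Q*` FROM A QUASI-RECONSTRUCTION.**  `A` Hermitian, invertible, `Re g*Ag ≥ 0`; block test
vectors `q` and ANY family `r` whose superpositions `ρ_B = Σ_y B_y r_y` have MASS COERCIVITY `c‖B‖² ≤ Re ρ_B*(Σ_y B_y q_y)`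
and ENERGY `Re ρ_B*Aρ_B ≤ E‖B‖²` (`c, E > 0`).  Then `(c²∕E)‖B‖² ≤ Re B*(sandwich A q)B`: completion of squares with
`(c∕E)·ρ_B`.  The variational dual of [B6] (2.76). [cite: Balaban1984PropagatorsII, (2.72)–(2.78) p.236] -/
theorem sandwich_coercive_of_quasiReconstruction (A : Matrix X X ℂ) (hH : A.IsHermitian) (hU : IsUnit A)
    (hpsd : ∀ g : X → ℂ, 0 ≤ (star g ⬝ᵥ (A *ᵥ g)).re) (q r : Y → X → ℂ) {c E : ℝ} (hc : 0 < c) (hE : 0 < E)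
    (hmass : ∀ B : Y → ℂ, c * nsq B ≤ (star (superpose r B) ⬝ᵥ superpose q B).re)
    (hen : ∀ B : Y → ℂ, (star (superpose r B) ⬝ᵥ (A *ᵥ superpose r B)).re ≤ E * nsq B) (B : Y → ℂ) :
    c ^ 2 / E * nsq B ≤ (star B ⬝ᵥ (sandwich A q *ᵥ B)).re := by
  rw [form_sandwich_eq]
  set w := superpose q B
  set ρ := superpose r B
  set t : ℝ := c / E with ht
  have ht0 : 0 ≤ t := div_nonneg hc.le hE.le
  have h := re_form_inv_ge A hH hU hpsd w (((t : ℝ) : ℂ) • ρ)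
  have h1 : (star (((t : ℝ) : ℂ) • ρ) ⬝ᵥ w).re = t * (star ρ ⬝ᵥ w).re := by
    rw [star_smul, smul_dotProduct, smul_eq_mul, Complex.star_def, Complex.conj_ofReal, Complex.re_ofReal_mul]
  have h2 : (star (((t : ℝ) : ℂ) • ρ) ⬝ᵥ (A *ᵥ (((t : ℝ) : ℂ) • ρ))).re = t * t * (star ρ ⬝ᵥ (A *ᵥ ρ)).re := by
    rw [star_smul, Matrix.mulVec_smul, smul_dotProduct, dotProduct_smul, smul_eq_mul, smul_eq_mul,
      Complex.star_def, Complex.conj_ofReal, ← mul_assoc, ← Complex.ofReal_mul, Complex.re_ofReal_mul]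
  rw [h1, h2] at h
  have hm := hmass B
  have he := hen B
  -- 2t·c‖B‖² − t²·E‖B‖² ≤ 2t·Re ρ*w − t²·Re ρ*Aρ ≤ Re w*A⁻¹w, and 2tc − t²E = c²/E at t = c/E
  have h3 : 2 * (t * (c * nsq B)) - t * t * (E * nsq B) ≤ (star w ⬝ᵥ (A⁻¹ *ᵥ w)).re := by
    have := mul_le_mul_of_nonneg_left hm ht0
    have := mul_le_mul_of_nonneg_left he (mul_nonneg ht0 ht0)
    linarith
  have h4 : 2 * (t * (c * nsq B)) - t * t * (E * nsq B) = c ^ 2 / E * nsq B := by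
    rw [ht]; field_simp; ring
  linarith

/-- The EXACT case recovers the co-owner's lemma's shape: `Qm r·(Qm q)ᴴ = 1` gives mass coercivity with `c = 1`, hence
`(1∕E)‖B‖² ≤ Re B*(sandwich A q)B`. [folklore] -/
theorem sandwich_coercive_of_exact [DecidableEq Y] (A : Matrix X X ℂ) (hH : A.IsHermitian) (hU : IsUnit A)
    (hpsd : ∀ g : X → ℂ, 0 ≤ (star g ⬝ᵥ (A *ᵥ g)).re) (q r : Y → X → ℂ) (hbi : Qm r * (Qm q)ᴴ = 1) {E : ℝ}
    (hE : 0 < E) (hen : ∀ B : Y → ℂ, (star (superpose r B) ⬝ᵥ (A *ᵥ superpose r B)).re ≤ E * nsq B) (B : Y → ℂ) :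
    1 ^ 2 / E * nsq B ≤ (star B ⬝ᵥ (sandwich A q *ᵥ B)).re :=
  sandwich_coercive_of_quasiReconstruction A hH hU hpsd q r one_pos hE (fun B => by
    rw [UnitLatticeProjectionWalk.star_superpose_dotProduct q r hbi B, Complex.ofReal_re, one_mul]) hen B

/-! ## §2 Mass coercivity from diagonal dominance of the mass matrix -/

/-- The MASS MATRIX of the pair `(r, q)`: `Mq y y′ = r_y* · q_{y′}` summed over the fine lattice, i.e. `Qm r·(Qm q)ᴴ`.
[folklore] -/
def massMatrix (r q : Y → X → ℂ) : Matrix Y Y ℂ := Qm r * (Qm q)ᴴ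

omit [DecidableEq X] in
/-- The mass pairing IS the form of the mass matrix: `(Σ B_y r_y)*(Σ B_y q_y) = B*·(Qm r·(Qm q)ᴴ)·B`. [folklore] -/
theorem star_superpose_dotProduct_eq (r q : Y → X → ℂ) (B : Y → ℂ) :
    star (superpose r B) ⬝ᵥ superpose q B = star B ⬝ᵥ (massMatrix r q *ᵥ B) := by
  rw [superpose, superpose, Matrix.star_mulVec, Matrix.conjTranspose_conjTranspose, ← Matrix.dotProduct_mulVec,
    Matrix.mulVec_mulVec, massMatrix]

omit [Fintype X] [DecidableEq X] in
/-- **Gershgorin-type form bound.**  A Hermitian matrix `Mq` with real diagonal `≥ δ` and absolute off-diagonal row sums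
`Σ_{y′ ≠ y}‖Mq y y′‖ ≤ σ` satisfies `Re B*·Mq·B ≥ (δ − σ)‖B‖²` (`2|B_y||B_{y′}| ≤ |B_y|² + |B_{y′}|²` and symmetry of
`‖Mq y y′‖`). [folklore] -/
theorem re_form_ge_of_diagDominant [DecidableEq Y] (Mq : Matrix Y Y ℂ) (hH : Mq.IsHermitian) {δ σ : ℝ}
    (hdiag : ∀ y, δ ≤ (Mq y y).re) (hoff : ∀ y, ∑ y' ∈ univ.erase y, ‖Mq y y'‖ ≤ σ) (B : Y → ℂ) :
    (δ - σ) * nsq B ≤ (star B ⬝ᵥ (Mq *ᵥ B)).re := by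
  -- Re B*MB = Σ_y Re(conj B_y · M y y · B_y) + Σ_{y ≠ y'} Re(conj B_y · M y y' · B_y')
  have hsplit : (star B ⬝ᵥ (Mq *ᵥ B)).re =
      ∑ y, ((Mq y y).re * ‖B y‖ ^ 2 + ∑ y' ∈ univ.erase y, (star (B y) * (Mq y y' * B y')).re) := by
    simp only [dotProduct, Matrix.mulVec, Pi.star_apply, Complex.re_sum, Finset.mul_sum]
    refine Finset.sum_congr rfl fun y _ => ?_
    rw [← Finset.add_sum_erase _ _ (Finset.mem_univ y)]
    congr 1
    -- conj B_y * (M y y * B_y) has real part Re(M y y)·|B_y|²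
    have hre : (star (B y) * (Mq y y * B y)) = Mq y y * ((‖B y‖ ^ 2 : ℝ) : ℂ) := by
      rw [Complex.star_def, mul_left_comm, Complex.conj_mul', Complex.ofReal_pow]
    rw [hre, Complex.re_mul_ofReal]
  -- lower bound of the off-diagonal part
  have hoffB : ∀ y, -(∑ y' ∈ univ.erase y, ‖Mq y y'‖ * ((‖B y‖ ^ 2 + ‖B y'‖ ^ 2) / 2)) ≤
      ∑ y' ∈ univ.erase y, (star (B y) * (Mq y y' * B y')).re := by
    intro y
    rw [← Finset.sum_neg_distrib]
    refine Finset.sum_le_sum fun y' _ => ?_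
    have habs : |(star (B y) * (Mq y y' * B y')).re| ≤ ‖B y‖ * (‖Mq y y'‖ * ‖B y'‖) := by
      refine (Complex.abs_re_le_norm _).trans ?_
      rw [norm_mul, norm_mul, norm_star]
    have hamgm : ‖B y‖ * (‖Mq y y'‖ * ‖B y'‖) ≤ ‖Mq y y'‖ * ((‖B y‖ ^ 2 + ‖B y'‖ ^ 2) / 2) := by
      have h2 : 2 * ‖B y‖ * ‖B y'‖ ≤ ‖B y‖ ^ 2 + ‖B y'‖ ^ 2 := two_mul_le_add_sq _ _
      nlinarith [norm_nonneg (Mq y y'), norm_nonneg (B y), norm_nonneg (B y')]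
    linarith [(abs_le.1 habs).1]
  -- symmetry: Σ_y Σ_{y'≠y} ‖M y y'‖ ‖B y'‖² = Σ_y Σ_{y'≠y} ‖M y' y‖ ‖B y‖² and ‖M y' y‖ = ‖M y y'‖
  have hsymm : ∑ y, ∑ y' ∈ univ.erase y, ‖Mq y y'‖ * ‖B y'‖ ^ 2 = ∑ y, ∑ y' ∈ univ.erase y, ‖Mq y y'‖ * ‖B y‖ ^ 2 := by
    have hnorm : ∀ y y', ‖Mq y' y‖ = ‖Mq y y'‖ := fun y y' => by
      conv_lhs => rw [← hH]
      rw [Matrix.conjTranspose_apply, norm_star]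
    rw [Finset.sum_comm' (t' := univ) (s' := fun y' => univ.erase y')
      (fun y y' => by simp only [Finset.mem_univ, Finset.mem_erase, ne_eq, and_true, true_and]; exact ne_comm)]
    refine Finset.sum_congr rfl fun y' _ => Finset.sum_congr rfl fun y _ => ?_
    rw [hnorm y' y]
  have hoffsum : ∀ y, (∑ y' ∈ univ.erase y, ‖Mq y y'‖) * ‖B y‖ ^ 2 ≤ σ * ‖B y‖ ^ 2 := fun y =>
    mul_le_mul_of_nonneg_right (hoff y) (by positivity)
  rw [hsplit, nsq]
  calc (δ - σ) * ∑ y, ‖B y‖ ^ 2 = ∑ y, (δ * ‖B y‖ ^ 2 - σ * ‖B y‖ ^ 2) := by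
        rw [Finset.mul_sum]; exact Finset.sum_congr rfl fun y _ => by ring
    _ ≤ ∑ y, ((Mq y y).re * ‖B y‖ ^ 2 - (∑ y' ∈ univ.erase y, ‖Mq y y'‖) * ‖B y‖ ^ 2) := by
        refine Finset.sum_le_sum fun y _ => sub_le_sub ?_ (hoffsum y)
        exact mul_le_mul_of_nonneg_right (hdiag y) (by positivity)
    _ = ∑ y, ((Mq y y).re * ‖B y‖ ^ 2 -
          ∑ y' ∈ univ.erase y, ‖Mq y y'‖ * ((‖B y‖ ^ 2 + ‖B y'‖ ^ 2) / 2)) := by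
        -- by symmetry the two halves of (‖B y‖² + ‖B y'‖²)/2 contribute equally
        have hhalf : ∑ y, ∑ y' ∈ univ.erase y, ‖Mq y y'‖ * ((‖B y‖ ^ 2 + ‖B y'‖ ^ 2) / 2) =
            ∑ y, (∑ y' ∈ univ.erase y, ‖Mq y y'‖) * ‖B y‖ ^ 2 := by
          have : ∑ y, ∑ y' ∈ univ.erase y, ‖Mq y y'‖ * ((‖B y‖ ^ 2 + ‖B y'‖ ^ 2) / 2) =
              (∑ y, ∑ y' ∈ univ.erase y, ‖Mq y y'‖ * ‖B y‖ ^ 2 +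
                ∑ y, ∑ y' ∈ univ.erase y, ‖Mq y y'‖ * ‖B y'‖ ^ 2) / 2 := by
            rw [← Finset.sum_add_distrib, Finset.sum_div]
            refine Finset.sum_congr rfl fun y _ => ?_
            rw [← Finset.sum_add_distrib, Finset.sum_div]
            refine Finset.sum_congr rfl fun y' _ => by ring
          rw [this, hsymm, ← two_mul, mul_div_cancel_left₀ _ (two_ne_zero)]
          refine Finset.sum_congr rfl fun y _ => by rw [Finset.sum_mul]
        rw [Finset.sum_sub_distrib, Finset.sum_sub_distrib, hhalf]
    _ ≤ ∑ y, ((Mq y y).re * ‖B y‖ ^ 2 + ∑ y' ∈ univ.erase y, (star (B y) * (Mq y y' * B y')).re) := by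
        refine Finset.sum_le_sum fun y _ => ?_
        linarith [hoffB y]

omit [DecidableEq X] in
/-- **Mass coercivity from a diagonally dominant Hermitian mass matrix**: the hypothesis `hmass` of
`sandwich_coercive_of_quasiReconstruction` with `c = δ − σ`. [folklore] -/
theorem massCoercive_of_diagDominant [DecidableEq Y] (r q : Y → X → ℂ) (hH : (massMatrix r q).IsHermitian)
    {δ σ : ℝ}
    (hdiag : ∀ y, δ ≤ (massMatrix r q y y).re) (hoff : ∀ y, ∑ y' ∈ univ.erase y, ‖massMatrix r q y y'‖ ≤ σ)
    (B : Y → ℂ) : (δ - σ) * nsq B ≤ (star (superpose r B) ⬝ᵥ superpose q B).re := by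
  rw [star_superpose_dotProduct_eq]
  exact re_form_ge_of_diagDominant _ hH hdiag hoff B

/-! ## §3 Non-vacuity: the scalar instance -/

/-- One fine site, one block, `A = 2·1`, `q = r = 1`: mass coercivity `c = 1`, energy `E = 2`, and the theorem gives
`½‖B‖² ≤ Re B*(sandwich A q)B` (indeed `sandwich A q = ½`). [folklore] -/
example (B : Unit → ℂ) :
    (1 : ℝ) ^ 2 / 2 * nsq B ≤ (star B ⬝ᵥ (sandwich ((2 : ℂ) • (1 : Matrix Unit Unit ℂ)) (fun _ _ => (1 : ℂ)) *ᵥ B)).re := by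
  have hH : ((2 : ℂ) • (1 : Matrix Unit Unit ℂ)).IsHermitian := by
    rw [Matrix.IsHermitian, Matrix.conjTranspose_smul, Matrix.conjTranspose_one]
    norm_num
  have hU : IsUnit ((2 : ℂ) • (1 : Matrix Unit Unit ℂ)) := by
    rw [Matrix.isUnit_iff_isUnit_det, Matrix.det_smul, Matrix.det_one, mul_one, Fintype.card_unit, pow_one]
    exact isUnit_iff_ne_zero.2 two_ne_zero
  refine sandwich_coercive_of_quasiReconstruction _ hH hU (fun g => ?_) (fun _ _ => (1 : ℂ)) (fun _ _ => (1 : ℂ))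
    one_pos two_pos (fun B' => ?_) (fun B' => ?_) B
  · -- Re g*(2·1)g = 2‖g‖² ≥ 0
    rw [Matrix.smul_mulVec, Matrix.one_mulVec, dotProduct_smul, smul_eq_mul, star_dotProduct_self,
      show (2 : ℂ) * ((nsq g : ℝ) : ℂ) = ((2 * nsq g : ℝ) : ℂ) by push_cast; ring, Complex.ofReal_re]
    exact mul_nonneg zero_le_two (nsq_nonneg g)
  · -- mass: (Σ B r)*(Σ B q) = ‖B‖² since r = q = 1 on one site
    have hs : ∀ B' : Unit → ℂ, superpose (fun (_ : Unit) (_ : Unit) => (1 : ℂ)) B' = B' := fun B' => by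
      ext x
      simp [superpose, Qm, Matrix.mulVec, dotProduct]
    rw [hs, star_dotProduct_self, Complex.ofReal_re, one_mul]
  · have hs : ∀ B' : Unit → ℂ, superpose (fun (_ : Unit) (_ : Unit) => (1 : ℂ)) B' = B' := fun B' => by
      ext x
      simp [superpose, Qm, Matrix.mulVec, dotProduct]
    rw [hs, Matrix.smul_mulVec, Matrix.one_mulVec, dotProduct_smul, smul_eq_mul, star_dotProduct_self,
      show (2 : ℂ) * ((nsq B' : ℝ) : ℂ) = ((2 * nsq B' : ℝ) : ℂ) by push_cast; ring, Complex.ofReal_re]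

end

end Summit.QuantumFields.BalabanUV.Beta.CoarseCoerciveQuasiReconstruction
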